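import Literature.NumberTheory.ConnesConsani2021.WindowOperatorCompact
import Mathlib.Analysis.SpecialFunctions.Integrals.Basic
import HarnessLib

/-!
# Connes–Consani 2021, §6.4: the vectors `ξ_α`, the identity (opkf1) `windowOp(L⁻¹e(αv/L)) = e_α`,
# and "(opT) ⇒ (kT)": the finite rank approximant `T` is the window operator of the
# trigonometric kernel `τ(λ,α,d,m)` of (approx0) — PROVED

A. Connes, C. Consani, *Weil positivity and trace formula, the archimedean place*, Selecta Math.
(N.S.) 27 (2021), Paper No. 77 = arXiv:2006.13771 [bib: `ConnesConsani2021`]; §6.3 display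
(approx0) and §6.4 (= arXiv pp. 24–25): displays (xialpha), (opkf1), (opT), Lemma 6.3 (= arXiv
Lemma 36) and the first display (kT) of its proof; the last sentence of the proof of Lemma 6.4
(= arXiv Lemma 37).

**What is printed.**  §6.3 (approx0): "one can approximate the function
`ϖ(x) := (Qε)(exp(x))/(2ε′(1₊))` in `[0, log 2]` by a trigonometric expression of the form
`τ(λ,α,d,m)(x) := (2λ/log 2)(½ + Σ_{n=1}^{m} (cos(2πnx/log 2) − d(n) cos(2πα_n x/log 2)))`."
§6.4: "we consider the Hilbert space `𝓗 := L²([−½log 2, ½log 2], dx)`.  For `α ∈ ℝ` we let (xialpha)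
`ξ_α(x) := (log 2)^{−1/2} exp(2πiαx/log 2)`, `x ∈ [−½log 2, ½log 2]` and `e_α = |ξ_α⟩⟨ξ_α|` be the
associated orthogonal projection … One then has for any `ξ, η ∈ 𝓗`, using the special form (xialpha)
of the vector `ξ_α`, `⟨ξ|e_α(η)⟩ = ⟨ξ|ξ_α⟩⟨ξ_α|η⟩ = …` so that one obtains (opkf1)
`⟨ξ|e_α(ξ)⟩ = (log 2)⁻¹ ∫_{−log 2}^{log 2} ∫ ξ(x) ξ̄(x+v) exp(∓2πiαv/log 2) dx dv`" (see the remark on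
the sign below).  **Lemma 6.3**: "… the compact operator `𝐊_I` of (opkf) … is at a norm distance less
than `ε` from the finite rank operator (opT) `T = λ Σ_{n∈ℤ} (e_n − d(|n|) e_{α_n})`.  Here, we set
`α_{−n} = −α_n ∀n` and `d(0) = 0`; while for `n > m`, we set `α_n = n` and `d(n) = 1` so that all the
terms in the above sum for `|n| > m` vanish."  Proof, first display: "By (approx0), one has
`τ(λ,α,d,m)(v) = (λ/log 2) Σ_{−m}^{m} (exp(∓2πinv/log 2) − d(|n|) exp(∓2πiα_n v/log 2))` so that, by
(opkf1), the operator `T` of (opT) on `𝓗` fulfills the equality (kT)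
`⟨ξ|T(ξ)⟩ = ∫_{−log 2}^{log 2} ∫ ξ(x) ξ̄(x+v) τ(λ,α,d,m)(v) dx dv`."  Proof of Lemma 6.4, last
sentence: "The orthogonality of `ψ` to all the vectors `ξ_{α_n}` shows using (opT) that
`Tψ = λ Σ e_n ψ = λψ`".

**What is PROVED here**, for any interval `I = [a, b]`, `L = b − a > 0` (CC: `a = −½log 2`,
`b = ½log 2`, `L = log 2`), binding to the tree's `windowForm`/`windowOp` (the operators "defined by
(opkf)/(kT)", `KernelApproximation.lean`) and to the Schwartz-kernel description
`inner_windowOp_eq_integral_integral` (`WindowOperatorCompact.lean`):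

* (xialpha) `expVector a b α = ξ_α`, the class in `L²(I)` of `expFun a b α x = L^{−1/2} e^{2πiαx/L}`;
  `‖ξ_α‖ = 1` (`norm_expVector`); `⟨ξ_α|ξ⟩ = L^{−1/2}∫_I e^{−2πiαx/L} ξ(x) dx` as in the proof of
  Lemma 6.4 (`inner_expVector_left`); `e_α = |ξ_α⟩⟨ξ_α|` (`expProj`, `expProj_apply`, `inner_expProj`,
  `expProj_expVector`);
* **(opkf1)**: with `κ_α(v) = L⁻¹ e^{2πiαv/L}` (`expKernel`), for all `ξ, η ∈ L²(I)`,
  `⟨η | windowOp κ_α ξ⟩ = ⟨η|ξ_α⟩⟨ξ_α|ξ⟩` (`inner_windowOp_expKernel`), i.e. **`windowOp κ_α = e_α`**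
  (`windowOp_expKernel`) and `windowForm κ_α ξ ξ = |⟨ξ_α|ξ⟩|²` (`windowForm_expKernel_self`);
* **(opT) ⇒ (kT)**: with CC's conventions `α_{−n} = −α_n`, `d(|n|)`, `d(0) = 0` written out (the terms
  `|n| > m` vanish), `T = λ (e_0 + Σ_{n=1}^{m} ((e_n + e_{−n}) − d(n)(e_{α_n} + e_{−α_n})))` (`opT`) and
  the kernel `τ(λ,α,d,m)` of (approx0) VERBATIM (`tauKernel`; its exponential form of the proof of
  Lemma 6.3, `tauKernel_eq_tauExp`): `⟨η | T ξ⟩ = windowForm τ ξ η` (`inner_opT`, (kT): `inner_opT_self`),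
  i.e. **`windowOp τ = T`** (`windowOp_tauKernel`): CC's finite-rank approximant IS the window operator
  of `τ`, so that Lemma 6.3 in the tree's form `norm_windowOp_sub_windowOp_le` applies to it literally
  — `‖windowOp ϖ − T‖ ≤ ∫_{a−b}^{b−a} |τ − ϖ|` (`norm_windowOp_sub_opT_le`) — and the hypothesis (kT) of
  the literal `opNorm_sub_le_of_quadraticForm` is discharged for `T`;
* "both `T` and `𝐊_I` are self-adjoint" (§6.7): `τ` is real and even, hence `T` is self-adjoint
  (`isSelfAdjoint_opT`, via `isSelfAdjoint_windowOp`);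
* the last step of the proof of Lemma 6.4: if `ψ ⊥ ξ_{±α_n}` (`1 ≤ n ≤ m`) and
  `(e_0 + Σ_{n=1}^{m}(e_n + e_{−n}))ψ = ψ`, then `Tψ = λψ` (`opT_apply_of_orthogonal`);
* the Gram matrix of the `ξ_α` on CC's symmetric interval `[−L/2, L/2]` (proof of Lemma 6.6, p. 25:
  "`(ξ_α)_k = sin(π(α−k))/(π(α−k))`"; the matrix `J_{i,j} = ⟨ξ̃_i|ξ̃_j⟩` of §6.6 p. 26):
  `⟨ξ_α|ξ_β⟩ = sinc(π(β − α))` (`inner_expVector_expVector_symm`; general interval: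
  `inner_expVector_expVector`), in particular `(ξ_n)_{n∈ℤ}` is orthonormal (`orthonormal_expVector_int`
  — "the vectors `ξ_n` form an orthonormal basis of `𝓗`", proof of Lemma 6.4; completeness not typed).

**Remark on the sign in (opkf1).**  With the inner product conjugate-linear in the first variable —
Mathlib's convention and the source's (proof of Lemma 6.4: `⟨ξ_{α_n}|ψ⟩ = (log 2)^{−1/2}∫_I ψ(x)
exp(−2πiα_n x/log 2) dx`) — and the pairing `∫∫ ξ(x) ξ̄(x+v) κ(v) dx dv` of (opkf)/(kT) (the tree's
`windowForm κ ξ ξ`), the kernel representing `e_α` is `L⁻¹ exp(+2πiαv/L)`; the conjugate kernel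
`L⁻¹ exp(−2πiαv/L)` represents `e_{−α}` (`windowForm_conj_expKernel_self`).  Only the sums over `±n`
enter (opT)/(kT) — `τ` is real and even — so (kT) is insensitive to this convention.

Not typed here: Lemma 6.2 (Poisson), the Paley–Wiener part of Lemma 6.4 (the explicit eigenvector `ψ`,
`h(α_n) = 0`), Fact 6.1/6.5 (floating point), the values `λ = 1.05158`, `m = 1732`, `α_n`, `d(n)`
(supplementary tables).  No RH claim; no named fact is introduced (cell `pub-rhdoor`,
`HOME/lit/CC2021-RIGOUR-MAP.md` §1 item 7b).
-/

noncomputable section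

open MeasureTheory Set Complex Filter
open scoped ComplexConjugate InnerProductSpace Real

namespace Literature.NumberTheory.ConnesConsani2021

variable {a b : ℝ}

/-! ## Small helpers (integrability on the window, linearity of `windowForm` in the kernel) -/

/-- A continuous kernel is integrable on the compact window `[a − b, b − a]` (the kernels `ϖ`, `τ` of
(opkf)/(kT) are continuous). [cite: ConnesConsani2021, Lemma 6.3 §6.4 p. 24] -/
theorem integrableOn_window_of_continuous {κ : ℝ → ℂ} (hκ : Continuous κ) :
    IntegrableOn κ (Icc (a - b) (b - a)) :=
  hκ.continuousOn.integrableOn_compact isCompact_Icc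

/-- The zero extension of `ξ ∈ L²(I)` is in `L²(ℝ)`. [folklore] -/
private theorem memLp_zeroExt_aux (ξ : Lp ℂ 2 (volume.restrict (Icc a b))) :
    MemLp (zeroExt ξ) 2 volume :=
  (memLp_indicator_iff_restrict measurableSet_Icc).2 (Lp.memLp ξ)

/-- `v ↦ ∫ ξ(x) η̄(x+v) dx` is a.e. strongly measurable (Fubini integrand). [folklore] -/
private theorem aestronglyMeasurable_corrFun_aux {ξ η : ℝ → ℂ} (hξ : AEStronglyMeasurable ξ volume)
    (hη : AEStronglyMeasurable η volume) : AEStronglyMeasurable (corrFun ξ η) volume := by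
  have hF : AEStronglyMeasurable (fun z : ℝ × ℝ ↦ ξ z.2 * conj (η (z.2 + z.1)))
      ((volume : Measure ℝ).prod volume) :=
    hξ.comp_snd.mul
      (hη.comp_quasiMeasurePreserving (quasiMeasurePreserving_add_swap volume volume)).star
  exact hF.integral_prod_right'

/-- The integrand `v ↦ f(v) κ(v)` of the window form is integrable on the window for `κ ∈ L¹` there
(`f` bounded by `‖ξ‖‖η‖`, `norm_corrFun_le`). [folklore] -/
private theorem integrable_corrFun_mul_aux {κ : ℝ → ℂ} (hκ : IntegrableOn κ (Icc (a - b) (b - a)))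
    (ξ η : Lp ℂ 2 (volume.restrict (Icc a b))) :
    IntegrableOn (fun v ↦ corrFun (zeroExt ξ) (zeroExt η) v * κ v) (Icc (a - b) (b - a)) :=
  Integrable.bdd_mul hκ
    (aestronglyMeasurable_corrFun_aux (memLp_zeroExt_aux ξ).1 (memLp_zeroExt_aux η).1).restrict
    (Eventually.of_forall fun v ↦ norm_corrFun_le (memLp_zeroExt_aux ξ) (memLp_zeroExt_aux η) v)

/-- `windowForm` is homogeneous in the kernel — the linearity in the kernel by which "(opkf1)" gives
"(kT)" for the trigonometric sum `τ` (proof of Lemma 6.3, p. 25).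
[cite: ConnesConsani2021, Lemma 6.3 §6.4 p. 25 (proof)] -/
theorem windowForm_const_mul_kernel (c : ℂ) (κ : ℝ → ℂ) (ξ η : Lp ℂ 2 (volume.restrict (Icc a b))) :
    windowForm a b (fun v ↦ c * κ v) ξ η = c * windowForm a b κ ξ η := by
  simp only [windowForm, kernelForm]
  rw [← integral_const_mul]
  refine integral_congr_ae (Eventually.of_forall fun v ↦ ?_)
  ring

/-- `windowForm` is additive in the kernel (kernels in `L¹` of the window) — linearity step of
"(opkf1) ⇒ (kT)" (proof of Lemma 6.3, p. 25). [cite: ConnesConsani2021, Lemma 6.3 §6.4 p. 25 (proof)] -/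
theorem windowForm_add_kernel {κ₁ κ₂ : ℝ → ℂ} (h₁ : IntegrableOn κ₁ (Icc (a - b) (b - a)))
    (h₂ : IntegrableOn κ₂ (Icc (a - b) (b - a))) (ξ η : Lp ℂ 2 (volume.restrict (Icc a b))) :
    windowForm a b (fun v ↦ κ₁ v + κ₂ v) ξ η = windowForm a b κ₁ ξ η + windowForm a b κ₂ ξ η := by
  simp only [windowForm, kernelForm, mul_add]
  exact integral_add (integrable_corrFun_mul_aux h₁ ξ η) (integrable_corrFun_mul_aux h₂ ξ η)

/-- `windowForm` respects differences of kernels (kernels in `L¹` of the window) — linearity step of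
"(opkf1) ⇒ (kT)" (proof of Lemma 6.3, p. 25). [cite: ConnesConsani2021, Lemma 6.3 §6.4 p. 25 (proof)] -/
theorem windowForm_sub_kernel {κ₁ κ₂ : ℝ → ℂ} (h₁ : IntegrableOn κ₁ (Icc (a - b) (b - a)))
    (h₂ : IntegrableOn κ₂ (Icc (a - b) (b - a))) (ξ η : Lp ℂ 2 (volume.restrict (Icc a b))) :
    windowForm a b (fun v ↦ κ₁ v - κ₂ v) ξ η = windowForm a b κ₁ ξ η - windowForm a b κ₂ ξ η := by
  simp only [windowForm, kernelForm, mul_sub]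
  exact integral_sub (integrable_corrFun_mul_aux h₁ ξ η) (integrable_corrFun_mul_aux h₂ ξ η)

/-- `windowForm` respects finite sums of kernels (kernels in `L¹` of the window) — linearity step of
"(opkf1) ⇒ (kT)" (proof of Lemma 6.3, p. 25). [cite: ConnesConsani2021, Lemma 6.3 §6.4 p. 25 (proof)] -/
theorem windowForm_finset_sum_kernel {ι : Type*} (s : Finset ι) {κ : ι → ℝ → ℂ}
    (h : ∀ i ∈ s, IntegrableOn (κ i) (Icc (a - b) (b - a)))
    (ξ η : Lp ℂ 2 (volume.restrict (Icc a b))) :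
    windowForm a b (fun v ↦ ∑ i ∈ s, κ i v) ξ η = ∑ i ∈ s, windowForm a b (κ i) ξ η := by
  simp only [windowForm, kernelForm, Finset.mul_sum]
  exact integral_finsetSum s fun i hi ↦ integrable_corrFun_mul_aux (h i hi) ξ η

/-! ## The functions `ξ_α` of (xialpha) and the kernels `κ_α` of (opkf1) -/

/-- CC's `ξ_α` as a function: `ξ_α(x) = L^{−1/2} exp(2πiαx/L)`, `L = b − a` (CC: `L = log 2`,
`ξ_α(x) = (log 2)^{−1/2} exp(2πiαx/log 2)`). [cite: ConnesConsani2021, §6.4 display (xialpha) p. 24] -/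
def expFun (a b α : ℝ) (x : ℝ) : ℂ :=
  (((Real.sqrt (b - a))⁻¹ : ℝ) : ℂ) * Complex.exp (((2 * π * α * x / (b - a) : ℝ) : ℂ) * I)

/-- `ξ_α` is continuous. [cite: ConnesConsani2021, §6.4 display (xialpha) p. 24] -/
theorem continuous_expFun (a b α : ℝ) : Continuous (expFun a b α) :=
  continuous_const.mul (Complex.continuous_exp.comp
    ((Complex.continuous_ofReal.comp ((continuous_const.mul continuous_id).div_const _)).mul
      continuous_const))

/-- `|ξ_α(x)| = L^{−1/2}`. [cite: ConnesConsani2021, §6.4 display (xialpha) p. 24] -/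
theorem norm_expFun (a b α x : ℝ) : ‖expFun a b α x‖ = (Real.sqrt (b - a))⁻¹ := by
  rw [expFun, norm_mul, Complex.norm_exp_ofReal_mul_I, mul_one, Complex.norm_real, Real.norm_eq_abs,
    abs_of_nonneg (inv_nonneg.2 (Real.sqrt_nonneg _))]

/-- `conj ξ_α(x) = ξ_{−α}(x)`. [cite: ConnesConsani2021, §6.4 display (xialpha) p. 24] -/
theorem conj_expFun (a b α x : ℝ) : conj (expFun a b α x) = expFun a b (-α) x := by
  rw [expFun, expFun, map_mul, Complex.conj_ofReal, ← Complex.exp_conj, map_mul, Complex.conj_ofReal,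
    Complex.conj_I]
  congr 2
  push_cast
  ring

/-- The kernel of (opkf1): `κ_α(v) = L⁻¹ exp(2πiαv/L)` (CC: `(log 2)⁻¹ exp(±2πiαv/log 2)`, see the
module docstring for the sign). [cite: ConnesConsani2021, §6.4 display (opkf1) p. 24] -/
def expKernel (a b α : ℝ) (v : ℝ) : ℂ :=
  (((b - a)⁻¹ : ℝ) : ℂ) * Complex.exp (((2 * π * α * v / (b - a) : ℝ) : ℂ) * I)

/-- `κ_α` is continuous. [cite: ConnesConsani2021, §6.4 display (opkf1) p. 24] -/
theorem continuous_expKernel (a b α : ℝ) : Continuous (expKernel a b α) :=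
  continuous_const.mul (Complex.continuous_exp.comp
    ((Complex.continuous_ofReal.comp ((continuous_const.mul continuous_id).div_const _)).mul
      continuous_const))

/-- `κ_α ∈ L¹` of the window. [cite: ConnesConsani2021, §6.4 display (opkf1) p. 24] -/
theorem integrableOn_expKernel (a b α : ℝ) : IntegrableOn (expKernel a b α) (Icc (a - b) (b - a)) :=
  integrableOn_window_of_continuous (continuous_expKernel a b α)

/-- `conj κ_α(v) = κ_{−α}(v)`: the conjugate kernel carries the opposite exponent.
[cite: ConnesConsani2021, §6.4 display (opkf1) p. 24] -/
theorem conj_expKernel (a b α v : ℝ) : conj (expKernel a b α v) = expKernel a b (-α) v := by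
  rw [expKernel, expKernel, map_mul, Complex.conj_ofReal, ← Complex.exp_conj, map_mul,
    Complex.conj_ofReal, Complex.conj_I]
  congr 2
  push_cast
  ring

/-- `κ_α(0) = L⁻¹`. [cite: ConnesConsani2021, §6.4 display (opkf1) p. 24] -/
theorem expKernel_apply_zero (a b α : ℝ) : expKernel a b α 0 = (((b - a)⁻¹ : ℝ) : ℂ) := by
  simp [expKernel]

/-- `κ_0(v) = L⁻¹` (the constant term of `τ`). [cite: ConnesConsani2021, §6.4 display (opkf1) p. 24] -/
theorem expKernel_freq_zero (a b v : ℝ) : expKernel a b 0 v = (((b - a)⁻¹ : ℝ) : ℂ) := by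
  simp [expKernel]

/-- "using the special form (xialpha) of the vector `ξ_α`" (p. 24): `κ_α(y − x) = ξ_α(y) conj ξ_α(x)`.
[cite: ConnesConsani2021, §6.4 p. 24] -/
theorem expKernel_sub (hab : a < b) (α x y : ℝ) :
    expKernel a b α (y - x) = expFun a b α y * conj (expFun a b α x) := by
  have hba : 0 < b - a := sub_pos.2 hab
  rw [conj_expFun, expFun, expFun, expKernel, mul_mul_mul_comm, ← Complex.exp_add,
    ← Complex.ofReal_mul, ← mul_inv, Real.mul_self_sqrt hba.le]
  congr 2
  push_cast
  ring

/-! ## The vectors `ξ_α ∈ 𝓗 = L²(I)` -/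

/-- `ξ_α ∈ L²(I)` (bounded continuous function on a set of finite measure). [folklore] -/
private theorem memLp_expFun (a b α : ℝ) : MemLp (expFun a b α) 2 (volume.restrict (Icc a b)) :=
  MemLp.of_bound (continuous_expFun a b α).aestronglyMeasurable _
    (Eventually.of_forall fun x ↦ (norm_expFun a b α x).le)

/-- **CC's vector `ξ_α ∈ 𝓗 = L²(I, dx)`** of (xialpha): the class of `x ↦ L^{−1/2} exp(2πiαx/L)` on
`I = [a, b]`, `L = b − a`. [cite: ConnesConsani2021, §6.4 display (xialpha) p. 24] -/
def expVector (a b α : ℝ) : Lp ℂ 2 (volume.restrict (Icc a b)) :=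
  (memLp_expFun a b α).toLp _

/-- `expVector a b α = ξ_α` a.e. on `I`. [cite: ConnesConsani2021, §6.4 display (xialpha) p. 24] -/
theorem coeFn_expVector (a b α : ℝ) :
    (expVector a b α : ℝ → ℂ) =ᵐ[volume.restrict (Icc a b)] expFun a b α := by
  unfold expVector
  exact MemLp.coeFn_toLp _

/-- **`‖ξ_α‖ = 1`** (`e_α = |ξ_α⟩⟨ξ_α|` is "the associated orthogonal projection"; the `ξ_n` "form an
orthonormal basis of `𝓗`", proof of Lemma 6.4). [cite: ConnesConsani2021, §6.4 p. 24] -/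
theorem norm_expVector (hab : a < b) (α : ℝ) : ‖expVector a b α‖ = 1 := by
  have hba : 0 < b - a := sub_pos.2 hab
  have h2 : ‖expVector a b α‖ ^ 2 = 1 := by
    rw [← inner_self_eq_norm_sq (𝕜 := ℂ), L2.inner_def]
    have h1 : ∫ x in Icc a b, ⟪(expVector a b α : ℝ → ℂ) x, (expVector a b α : ℝ → ℂ) x⟫_ℂ
        = ∫ _ in Icc a b, (((b - a)⁻¹ : ℝ) : ℂ) := by
      refine integral_congr_ae ?_
      filter_upwards [coeFn_expVector a b α] with x hx
      rw [hx, RCLike.inner_apply', mul_comm, ← expKernel_sub hab α x x, sub_self, expKernel_apply_zero]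
    rw [h1, setIntegral_const, Real.volume_real_Icc_of_le hab.le, Complex.real_smul,
      ← Complex.ofReal_mul, mul_inv_cancel₀ hba.ne']
    simp
  rw [← Real.sqrt_sq (norm_nonneg _), h2, Real.sqrt_one]

/-- **`⟨ξ_α|ξ⟩ = L^{−1/2} ∫_I e^{−2πiαx/L} ξ(x) dx`** — "`⟨ξ_{α_n}|ψ⟩ = (log 2)^{−1/2} ∫_I ψ(x)
exp(−2πiα_n x/log 2) dx`" (proof of Lemma 6.4, p. 25).
[cite: ConnesConsani2021, Lemma 6.4 §6.5 p. 25 (proof)] -/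
theorem inner_expVector_left (α : ℝ) (ξ : Lp ℂ 2 (volume.restrict (Icc a b))) :
    ⟪expVector a b α, ξ⟫_ℂ = ∫ x in Icc a b, conj (expFun a b α x) * (ξ : ℝ → ℂ) x := by
  rw [L2.inner_def]
  refine integral_congr_ae ?_
  filter_upwards [coeFn_expVector a b α] with x hx
  rw [hx, RCLike.inner_apply']

/-- `⟨η|ξ_α⟩ = ∫_I η̄(y) ξ_α(y) dy`. [cite: ConnesConsani2021, §6.4 p. 24] -/
theorem inner_expVector_right (α : ℝ) (η : Lp ℂ 2 (volume.restrict (Icc a b))) :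
    ⟪η, expVector a b α⟫_ℂ = ∫ y in Icc a b, conj ((η : ℝ → ℂ) y) * expFun a b α y := by
  rw [L2.inner_def]
  refine integral_congr_ae ?_
  filter_upwards [coeFn_expVector a b α] with y hy
  rw [hy, RCLike.inner_apply']

/-! ## The projections `e_α = |ξ_α⟩⟨ξ_α|` -/

/-- **CC's `e_α = |ξ_α⟩⟨ξ_α|`**, "`e_α(ξ) = ξ_α ⟨ξ_α|ξ⟩`, `∀ξ ∈ 𝓗`", as a bounded operator on `L²(I)`.
[cite: ConnesConsani2021, §6.4 p. 24] -/
def expProj (a b α : ℝ) :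
    Lp ℂ 2 (volume.restrict (Icc a b)) →L[ℂ] Lp ℂ 2 (volume.restrict (Icc a b)) :=
  (innerSL ℂ (expVector a b α)).smulRight (expVector a b α)

/-- `e_α(ξ) = ⟨ξ_α|ξ⟩ ξ_α`. [cite: ConnesConsani2021, §6.4 p. 24] -/
theorem expProj_apply (α : ℝ) (ξ : Lp ℂ 2 (volume.restrict (Icc a b))) :
    expProj a b α ξ = ⟪expVector a b α, ξ⟫_ℂ • expVector a b α := by
  simp [expProj]

/-- "`⟨ξ|e_α(η)⟩ = ⟨ξ|ξ_α⟩⟨ξ_α|η⟩`" (p. 24): `⟨η | e_α ξ⟩ = ⟨η|ξ_α⟩⟨ξ_α|ξ⟩`.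
[cite: ConnesConsani2021, §6.4 p. 24] -/
theorem inner_expProj (α : ℝ) (ξ η : Lp ℂ 2 (volume.restrict (Icc a b))) :
    ⟪η, expProj a b α ξ⟫_ℂ = ⟪η, expVector a b α⟫_ℂ * ⟪expVector a b α, ξ⟫_ℂ := by
  rw [expProj_apply, inner_smul_right, mul_comm]

/-- `e_α ξ_α = ξ_α` (`‖ξ_α‖ = 1`): `e_α` fixes `ξ_α`, "the associated orthogonal projection".
[cite: ConnesConsani2021, §6.4 p. 24] -/
theorem expProj_expVector (hab : a < b) (α : ℝ) :
    expProj a b α (expVector a b α) = expVector a b α := by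
  rw [expProj_apply, inner_self_eq_norm_sq_to_K, norm_expVector hab]
  simp

/-! ## (opkf1): `windowOp (L⁻¹ e^{2πiαv/L}) = e_α` -/

/-- **(opkf1), polarised**: for all `ξ, η ∈ 𝓗 = L²(I)`,
`⟨η | windowOp κ_α ξ⟩ = ∫_{a−b}^{b−a} ∫ ξ(x) η̄(x+v) L⁻¹e^{2πiαv/L} dx dv = ⟨η|ξ_α⟩⟨ξ_α|ξ⟩ = ⟨η|e_α ξ⟩`
("`⟨ξ|e_α(η)⟩ = ⟨ξ|ξ_α⟩⟨ξ_α|η⟩ = L⁻¹∫_{I×I} ξ̄(x) e^{2πiαx/L} η(y) e^{−2πiαy/L} dx dy` so that one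
obtains (opkf1)", p. 24).  Proof as printed: the kernel `κ_α(y − x)` splits as `ξ_α(y) ξ̄_α(x)`.
[cite: ConnesConsani2021, §6.4 display (opkf1) p. 24] -/
theorem inner_windowOp_expKernel (hab : a < b) (α : ℝ) (ξ η : Lp ℂ 2 (volume.restrict (Icc a b))) :
    ⟪η, windowOp a b (integrableOn_expKernel a b α) ξ⟫_ℂ
      = ⟪η, expVector a b α⟫_ℂ * ⟪expVector a b α, ξ⟫_ℂ := by
  rw [inner_windowOp_eq_integral_integral (integrableOn_expKernel a b α) (continuous_expKernel a b α)]
  have hinner : ∀ y ∈ Icc a b,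
      ∫ x in Icc a b, windowKernel a b (expKernel a b α) (y - x) * (ξ : ℝ → ℂ) x
        = expFun a b α y * ∫ x in Icc a b, conj (expFun a b α x) * (ξ : ℝ → ℂ) x := by
    intro y hy
    rw [← integral_const_mul]
    refine setIntegral_congr_fun measurableSet_Icc fun x hx ↦ ?_
    rw [windowKernel_sub_of_mem hx hy, expKernel_sub hab, mul_assoc]
  have h1 : ∫ y in Icc a b, conj ((η : ℝ → ℂ) y) *
        ∫ x in Icc a b, windowKernel a b (expKernel a b α) (y - x) * (ξ : ℝ → ℂ) x
      = (∫ y in Icc a b, conj ((η : ℝ → ℂ) y) * expFun a b α y) *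
          ∫ x in Icc a b, conj (expFun a b α x) * (ξ : ℝ → ℂ) x := by
    rw [← integral_mul_const]
    refine setIntegral_congr_fun measurableSet_Icc fun y hy ↦ ?_
    rw [hinner y hy, mul_assoc]
  rw [h1, inner_expVector_right, inner_expVector_left]

/-- **(opkf1) as an identity of operators: `windowOp κ_α = e_α`** — the operator "defined by" the
kernel form with kernel `L⁻¹e^{2πiαv/L}` (the tree's `windowOp`, Prop. 5.5/Lemma 6.3) is the rank-one
projection `|ξ_α⟩⟨ξ_α|`. [cite: ConnesConsani2021, §6.4 display (opkf1) p. 24] -/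
theorem windowOp_expKernel (hab : a < b) (α : ℝ) :
    windowOp a b (integrableOn_expKernel a b α) = expProj a b α := by
  refine (windowOp_unique (integrableOn_expKernel a b α) fun ξ η ↦ ?_).symm
  rw [inner_expProj, ← inner_windowOp_expKernel hab, inner_windowOp]

/-- (opkf1) for the window FORM, polarised: `windowForm κ_α ξ η = ⟨η|ξ_α⟩⟨ξ_α|ξ⟩`.
[cite: ConnesConsani2021, §6.4 display (opkf1) p. 24] -/
theorem windowForm_expKernel (hab : a < b) (α : ℝ) (ξ η : Lp ℂ 2 (volume.restrict (Icc a b))) :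
    windowForm a b (expKernel a b α) ξ η = ⟪η, expVector a b α⟫_ℂ * ⟪expVector a b α, ξ⟫_ℂ := by
  rw [← inner_windowOp (integrableOn_expKernel a b α), inner_windowOp_expKernel hab]

/-- **(opkf1) literally (quadratic form)**: `∫_{a−b}^{b−a} ∫ ξ(x) ξ̄(x+v) L⁻¹e^{2πiαv/L} dx dv =
⟨ξ|e_α(ξ)⟩ = |⟨ξ_α|ξ⟩|²`. [cite: ConnesConsani2021, §6.4 display (opkf1) p. 24] -/
theorem windowForm_expKernel_self (hab : a < b) (α : ℝ) (ξ : Lp ℂ 2 (volume.restrict (Icc a b))) :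
    windowForm a b (expKernel a b α) ξ ξ = ((‖⟪expVector a b α, ξ⟫_ℂ‖ ^ 2 : ℝ) : ℂ) := by
  rw [windowForm_expKernel hab, ← inner_conj_symm ξ (expVector a b α), Complex.conj_mul']
  norm_cast

/-- The sign remark: the conjugate kernel `L⁻¹e^{−2πiαv/L}` (the exponent `−2πiαv/log 2` of the
display (opkf1)) gives, in the pairing `∫∫ ξ(x) ξ̄(x+v) κ(v)` with `⟨·|·⟩` conjugate-linear in the
first variable, `|⟨ξ_{−α}|ξ⟩|² = ⟨ξ|e_{−α}(ξ)⟩`. [cite: ConnesConsani2021, §6.4 display (opkf1) p. 24] -/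
theorem windowForm_conj_expKernel_self (hab : a < b) (α : ℝ)
    (ξ : Lp ℂ 2 (volume.restrict (Icc a b))) :
    windowForm a b (fun v ↦ conj (expKernel a b α v)) ξ ξ
      = ((‖⟪expVector a b (-α), ξ⟫_ℂ‖ ^ 2 : ℝ) : ℂ) := by
  rw [show (fun v ↦ conj (expKernel a b α v)) = expKernel a b (-α) from funext (conj_expKernel a b α),
    windowForm_expKernel_self hab]

/-! ## (approx0), (opT) and (kT): `T = windowOp τ(λ,α,d,m)` -/

/-- **CC's trigonometric kernel (approx0), verbatim**:
`τ(λ,α,d,m)(x) := (2λ/L)(½ + Σ_{n=1}^{m} (cos(2πnx/L) − d(n) cos(2πα_n x/L)))`, `L = b − a`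
(CC: `L = log 2`, `m = 1732`, `λ = 1.05158`, the angles `α_n` and coefficients `d(n)` of §6.2), a
real-valued function (cast to `ℂ`). [cite: ConnesConsani2021, §6.3 display (approx0) p. 24] -/
def tauKernel (a b lam : ℝ) (α d : ℕ → ℝ) (m : ℕ) (x : ℝ) : ℂ :=
  ((2 * lam / (b - a) * (1 / 2 + ∑ n ∈ Finset.Icc 1 m,
      (Real.cos (2 * π * n * x / (b - a)) - d n * Real.cos (2 * π * α n * x / (b - a)))) : ℝ) : ℂ)

/-- `τ` is even. [cite: ConnesConsani2021, §6.3 display (approx0) p. 24] -/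
theorem tauKernel_neg (a b lam : ℝ) (α d : ℕ → ℝ) (m : ℕ) (x : ℝ) :
    tauKernel a b lam α d m (-x) = tauKernel a b lam α d m x := by
  simp only [tauKernel, mul_neg, neg_div, Real.cos_neg]

/-- `τ` is real: `conj τ(x) = τ(x)`. [cite: ConnesConsani2021, §6.3 display (approx0) p. 24] -/
theorem conj_tauKernel (a b lam : ℝ) (α d : ℕ → ℝ) (m : ℕ) (x : ℝ) :
    conj (tauKernel a b lam α d m x) = tauKernel a b lam α d m x := by
  rw [tauKernel, Complex.conj_ofReal]

/-- `τ` is continuous. [cite: ConnesConsani2021, §6.3 display (approx0) p. 24] -/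
theorem continuous_tauKernel (a b lam : ℝ) (α d : ℕ → ℝ) (m : ℕ) :
    Continuous (tauKernel a b lam α d m) := by
  unfold tauKernel
  refine Complex.continuous_ofReal.comp (continuous_const.mul (continuous_const.add ?_))
  refine continuous_finsetSum _ fun n _ ↦ ?_
  exact (Real.continuous_cos.comp ((continuous_const.mul continuous_id).div_const _)).sub
    (continuous_const.mul (Real.continuous_cos.comp ((continuous_const.mul continuous_id).div_const _)))

/-- `τ ∈ L¹` of the window ("the `L¹` norm of the difference `τ(λ,α,d,m) − ϖ`", Lemma 6.3).
[cite: ConnesConsani2021, Lemma 6.3 §6.4 p. 24] -/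
theorem integrableOn_tauKernel (a b lam : ℝ) (α d : ℕ → ℝ) (m : ℕ) :
    IntegrableOn (tauKernel a b lam α d m) (Icc (a - b) (b - a)) :=
  integrableOn_window_of_continuous (continuous_tauKernel a b lam α d m)

/-- The exponential form of `τ` (proof of Lemma 6.3, first display, p. 25: "`τ(λ,α,d,m)(v) =
(λ/log 2) Σ_{−m}^{m} (exp(∓2πinv/log 2) − d(|n|) exp(∓2πiα_n v/log 2))`"), with the `±n` terms
grouped: `τ(v) = λ (κ_0(v) + Σ_{n=1}^{m} ((κ_n(v) + κ_{−n}(v)) − d(n)(κ_{α_n}(v) + κ_{−α_n}(v))))`.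
[cite: ConnesConsani2021, Lemma 6.3 §6.4 p. 25 (proof)] -/
def tauExp (a b lam : ℝ) (α d : ℕ → ℝ) (m : ℕ) (v : ℝ) : ℂ :=
  (lam : ℂ) * (expKernel a b 0 v + ∑ n ∈ Finset.Icc 1 m,
    ((expKernel a b n v + expKernel a b (-(n : ℝ)) v)
      - (d n : ℂ) * (expKernel a b (α n) v + expKernel a b (-(α n)) v)))

/-- `κ_β(v) + κ_{−β}(v) = L⁻¹ · 2cos(2πβv/L)`. [folklore] -/
private theorem expKernel_add_expKernel_neg (a b β v : ℝ) :
    expKernel a b β v + expKernel a b (-β) v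
      = (((b - a)⁻¹ * (2 * Real.cos (2 * π * β * v / (b - a))) : ℝ) : ℂ) := by
  have e : (((2 * π * (-β) * v / (b - a) : ℝ) : ℂ) * I)
      = -(((2 * π * β * v / (b - a) : ℝ) : ℂ)) * I := by
    push_cast
    ring
  rw [expKernel, expKernel, e, ← mul_add, ← Complex.two_cos]
  simp only [Complex.ofReal_mul, Complex.ofReal_cos, Complex.ofReal_ofNat]

/-- The real bookkeeping `(2λ/L)(½ + Σ (c_n − d_n e_n)) = λ (L⁻¹ + Σ (L⁻¹·2c_n − d_n (L⁻¹·2e_n)))`.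
[folklore] -/
private theorem tau_real_identity (a b lam : ℝ) (α d : ℕ → ℝ) (m : ℕ) (v : ℝ) :
    2 * lam / (b - a) * (1 / 2 + ∑ n ∈ Finset.Icc 1 m,
        (Real.cos (2 * π * n * v / (b - a)) - d n * Real.cos (2 * π * α n * v / (b - a))))
      = lam * ((b - a)⁻¹ + ∑ n ∈ Finset.Icc 1 m,
          ((b - a)⁻¹ * (2 * Real.cos (2 * π * n * v / (b - a)))
            - d n * ((b - a)⁻¹ * (2 * Real.cos (2 * π * α n * v / (b - a)))))) := by
  rw [mul_add, mul_add, Finset.mul_sum, Finset.mul_sum]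
  congr 1
  · ring
  · exact Finset.sum_congr rfl fun n _ ↦ by ring

/-- **(approx0) = the exponential form**: `τ(λ,α,d,m) = tauExp` ("By (approx0), one has
`τ(λ,α,d,m)(v) = (λ/log 2)Σ_{−m}^{m}(…)`", p. 25). [cite: ConnesConsani2021, Lemma 6.3 §6.4 p. 25 (proof)] -/
theorem tauKernel_eq_tauExp (a b lam : ℝ) (α d : ℕ → ℝ) (m : ℕ) :
    tauKernel a b lam α d m = tauExp a b lam α d m := by
  funext v
  have hs : ∀ n ∈ Finset.Icc 1 m,
      (expKernel a b n v + expKernel a b (-(n : ℝ)) v)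
        - (d n : ℂ) * (expKernel a b (α n) v + expKernel a b (-(α n)) v)
      = ((((b - a)⁻¹ * (2 * Real.cos (2 * π * n * v / (b - a)))
          - d n * ((b - a)⁻¹ * (2 * Real.cos (2 * π * α n * v / (b - a)))) : ℝ) : ℂ)) := by
    intro n _
    rw [expKernel_add_expKernel_neg, expKernel_add_expKernel_neg]
    simp only [Complex.ofReal_sub, Complex.ofReal_mul]
  rw [tauKernel, tau_real_identity, tauExp, expKernel_freq_zero, Finset.sum_congr rfl hs]
  simp only [Complex.ofReal_mul, Complex.ofReal_add, Complex.ofReal_sum, Complex.ofReal_sub]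

/-- **CC's finite rank operator `T` of (opT)**, `T = λ Σ_{n∈ℤ} (e_n − d(|n|) e_{α_n})` with the
conventions "`α_{−n} = −α_n`, `d(0) = 0`; for `n > m`, `α_n = n` and `d(n) = 1` so that all the terms
… for `|n| > m` vanish" written out:
`T = λ (e_0 + Σ_{n=1}^{m} ((e_n + e_{−n}) − d(n) (e_{α_n} + e_{−α_n})))`.
[cite: ConnesConsani2021, Lemma 6.3 §6.4 display (opT) p. 24] -/
def opT (a b lam : ℝ) (α d : ℕ → ℝ) (m : ℕ) :
    Lp ℂ 2 (volume.restrict (Icc a b)) →L[ℂ] Lp ℂ 2 (volume.restrict (Icc a b)) :=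
  (lam : ℂ) • (expProj a b 0 + ∑ n ∈ Finset.Icc 1 m,
    ((expProj a b n + expProj a b (-(n : ℝ))) - (d n : ℂ) • (expProj a b (α n) + expProj a b (-(α n)))))

/-- **(opT) ⇒ (kT), polarised**: for all `ξ, η ∈ 𝓗`,
`⟨η | T ξ⟩ = ∫_{a−b}^{b−a} ∫ ξ(x) η̄(x+v) τ(λ,α,d,m)(v) dx dv` — "by (opkf1), the operator `T` of (opT) on
`𝓗` fulfills the equality (kT)" (proof of Lemma 6.3, p. 25): expand `T` in the `e_β`, `τ` in the
`κ_β` (`tauKernel_eq_tauExp`), and use (opkf1) `windowForm κ_β ξ η = ⟨η|e_β ξ⟩` termwise.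
[cite: ConnesConsani2021, Lemma 6.3 §6.4 p. 25 (proof, display (kT))] -/
theorem inner_opT (hab : a < b) (lam : ℝ) (α d : ℕ → ℝ) (m : ℕ)
    (ξ η : Lp ℂ 2 (volume.restrict (Icc a b))) :
    ⟪η, opT a b lam α d m ξ⟫_ℂ = windowForm a b (tauKernel a b lam α d m) ξ η := by
  have hK : ∀ β : ℝ, Continuous (expKernel a b β) := continuous_expKernel a b
  have hW : ∀ {f : ℝ → ℂ}, Continuous f → IntegrableOn f (Icc (a - b) (b - a)) :=
    fun hf ↦ integrableOn_window_of_continuous hf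
  have hS : ∀ n : ℕ, Continuous fun v ↦ (expKernel a b n v + expKernel a b (-(n : ℝ)) v)
      - (d n : ℂ) * (expKernel a b (α n) v + expKernel a b (-(α n)) v) :=
    fun n ↦ ((hK _).add (hK _)).sub (continuous_const.mul ((hK _).add (hK _)))
  have hR : windowForm a b (tauKernel a b lam α d m) ξ η
      = (lam : ℂ) * (⟪η, expVector a b 0⟫_ℂ * ⟪expVector a b 0, ξ⟫_ℂ
          + ∑ n ∈ Finset.Icc 1 m,
            ((⟪η, expVector a b n⟫_ℂ * ⟪expVector a b n, ξ⟫_ℂ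
                + ⟪η, expVector a b (-(n : ℝ))⟫_ℂ * ⟪expVector a b (-(n : ℝ)), ξ⟫_ℂ)
              - (d n : ℂ) * (⟪η, expVector a b (α n)⟫_ℂ * ⟪expVector a b (α n), ξ⟫_ℂ
                + ⟪η, expVector a b (-(α n))⟫_ℂ * ⟪expVector a b (-(α n)), ξ⟫_ℂ))) := by
    rw [tauKernel_eq_tauExp]
    show windowForm a b (fun v ↦ (lam : ℂ) * (expKernel a b 0 v + ∑ n ∈ Finset.Icc 1 m,
      ((expKernel a b n v + expKernel a b (-(n : ℝ)) v)
        - (d n : ℂ) * (expKernel a b (α n) v + expKernel a b (-(α n)) v)))) ξ η = _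
    rw [windowForm_const_mul_kernel,
      windowForm_add_kernel (hW (hK 0)) (hW (continuous_finsetSum _ fun n _ ↦ hS n)),
      windowForm_finset_sum_kernel _ (fun n _ ↦ hW (hS n)), windowForm_expKernel hab]
    congr 2
    refine Finset.sum_congr rfl fun n _ ↦ ?_
    have h12 : IntegrableOn (fun v ↦ expKernel a b n v + expKernel a b (-(n : ℝ)) v)
        (Icc (a - b) (b - a)) := hW ((hK n).add (hK (-(n : ℝ))))
    have h34 : IntegrableOn
        (fun v ↦ (d n : ℂ) * (expKernel a b (α n) v + expKernel a b (-(α n)) v))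
        (Icc (a - b) (b - a)) := hW (continuous_const.mul ((hK (α n)).add (hK (-(α n)))))
    rw [windowForm_sub_kernel h12 h34, windowForm_add_kernel (hW (hK _)) (hW (hK _)),
      windowForm_const_mul_kernel, windowForm_add_kernel (hW (hK _)) (hW (hK _))]
    simp only [windowForm_expKernel hab]
  rw [hR]
  simp only [opT, FunLike.coe_smul, Pi.smul_apply, FunLike.coe_add, Pi.add_apply, FunLike.coe_sub,
    Pi.sub_apply, FunLike.coe_sum, Finset.sum_apply, inner_smul_right, inner_add_right,
    inner_sub_right, inner_sum, inner_expProj]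

/-- **(kT) literally**: `⟨ξ|T(ξ)⟩ = ∫_{a−b}^{b−a} ∫ ξ(x) ξ̄(x+v) τ(λ,α,d,m)(v) dx dv` — the hypothesis
`hT` of the literal Lemma 6.3 `opNorm_sub_le_of_quadraticForm`, DISCHARGED for CC's `T`.
[cite: ConnesConsani2021, Lemma 6.3 §6.4 p. 25 (proof, display (kT))] -/
theorem inner_opT_self (hab : a < b) (lam : ℝ) (α d : ℕ → ℝ) (m : ℕ)
    (ξ : Lp ℂ 2 (volume.restrict (Icc a b))) :
    ⟪ξ, opT a b lam α d m ξ⟫_ℂ = windowForm a b (tauKernel a b lam α d m) ξ ξ :=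
  inner_opT hab lam α d m ξ ξ

/-- **`T = windowOp τ(λ,α,d,m)`**: CC's finite rank approximant IS the operator "defined by" the kernel
form of the trigonometric kernel `τ` of (approx0) (uniqueness `windowOp_unique`).
[cite: ConnesConsani2021, Lemma 6.3 §6.4 pp. 24–25] -/
theorem windowOp_tauKernel (hab : a < b) (lam : ℝ) (α d : ℕ → ℝ) (m : ℕ) :
    windowOp a b (integrableOn_tauKernel a b lam α d m) = opT a b lam α d m :=
  (windowOp_unique _ fun ξ η ↦ inner_opT hab lam α d m ξ η).symm

/-- **Lemma 6.3 applied to CC's own approximant**: for any kernel `ϖ ∈ L¹` of the window,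
`‖windowOp ϖ − T‖ ≤ ∫_{a−b}^{b−a} |τ(λ,α,d,m) − ϖ|` — "the compact operator `𝐊_I` of (opkf) … is at
norm distance less than `ε` from the finite rank operator `T`" once `‖τ − ϖ‖_{L¹} ≤ ε` (Fact 6.1:
`ε₁ ≃ 0.00122`, not typed). [cite: ConnesConsani2021, Lemma 6.3 §6.4 p. 24] -/
theorem norm_windowOp_sub_opT_le (hab : a < b) {ϖ : ℝ → ℂ}
    (hϖ : IntegrableOn ϖ (Icc (a - b) (b - a))) (lam : ℝ) (α d : ℕ → ℝ) (m : ℕ) :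
    ‖windowOp a b hϖ - opT a b lam α d m‖
      ≤ ∫ v in Icc (a - b) (b - a), ‖tauKernel a b lam α d m v - ϖ v‖ := by
  rw [← windowOp_tauKernel hab]
  exact norm_windowOp_sub_windowOp_le hϖ (integrableOn_tauKernel a b lam α d m)

/-- **"both `T` and `𝐊_I` are self-adjoint"** (§6.7 p. 28) — for `T`: `τ` is real and even, so
`T = windowOp τ` is self-adjoint (`isSelfAdjoint_windowOp`).
[cite: ConnesConsani2021, §6.7 p. 28; Lemma 6.3 §6.4 p. 24] -/
theorem isSelfAdjoint_opT (hab : a < b) (lam : ℝ) (α d : ℕ → ℝ) (m : ℕ) :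
    IsSelfAdjoint (opT a b lam α d m) := by
  rw [← windowOp_tauKernel hab]
  exact isSelfAdjoint_windowOp _ fun v ↦ by rw [tauKernel_neg, conj_tauKernel]

/-- **The last step of the proof of Lemma 6.4** ("The orthogonality of `ψ` to all the vectors `ξ_{α_n}`
shows using (opT) that `Tψ = λ Σ e_n ψ = λψ`", p. 25), in the finite form of `T`: if
`⟨ξ_{±α_n}|ψ⟩ = 0` for `1 ≤ n ≤ m` and `(e_0 + Σ_{n=1}^{m} (e_n + e_{−n})) ψ = ψ` (in the source:
`Σ_{n∈ℤ} e_n = 1`, the `ξ_n` being an orthonormal basis, and `ψ ⊥ ξ_n` for `|n| > m`), then `Tψ = λψ`.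
The Paley–Wiener construction of `ψ` itself is not typed.
[cite: ConnesConsani2021, Lemma 6.4 §6.5 p. 25 (proof)] -/
theorem opT_apply_of_orthogonal (lam : ℝ) (α d : ℕ → ℝ) (m : ℕ)
    {ψ : Lp ℂ 2 (volume.restrict (Icc a b))}
    (hα : ∀ n ∈ Finset.Icc 1 m, ⟪expVector a b (α n), ψ⟫_ℂ = 0)
    (hα' : ∀ n ∈ Finset.Icc 1 m, ⟪expVector a b (-(α n)), ψ⟫_ℂ = 0)
    (hspan : expProj a b 0 ψ + ∑ n ∈ Finset.Icc 1 m,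
      (expProj a b n ψ + expProj a b (-(n : ℝ)) ψ) = ψ) :
    opT a b lam α d m ψ = (lam : ℂ) • ψ := by
  have hz : ∀ n ∈ Finset.Icc 1 m,
      expProj a b n ψ + expProj a b (-(n : ℝ)) ψ
          - (d n : ℂ) • (expProj a b (α n) ψ + expProj a b (-(α n)) ψ)
        = expProj a b n ψ + expProj a b (-(n : ℝ)) ψ := by
    intro n hn
    rw [expProj_apply (α n), expProj_apply (-(α n)), hα n hn, hα' n hn, zero_smul, zero_smul,
      add_zero, smul_zero, sub_zero]
  simp only [opT, FunLike.coe_smul, Pi.smul_apply, FunLike.coe_add, Pi.add_apply, FunLike.coe_sub,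
    Pi.sub_apply, FunLike.coe_sum, Finset.sum_apply]
  rw [Finset.sum_congr rfl hz, hspan]

/-! ## The Gram matrix of the `ξ_α` on CC's symmetric interval: `⟨ξ_k|ξ_α⟩ = sin(π(α−k))/(π(α−k))` -/

/-- `conj ξ_α(x) · ξ_β(x) = κ_{β−α}(x)`. [cite: ConnesConsani2021, Lemma 6.6 §6.6 p. 25 (proof)] -/
theorem conj_expFun_mul_expFun (hab : a < b) (α β x : ℝ) :
    conj (expFun a b α x) * expFun a b β x = expKernel a b (β - α) x := by
  have hba : 0 < b - a := sub_pos.2 hab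
  rw [conj_expFun, expFun, expFun, expKernel, mul_mul_mul_comm, ← Complex.exp_add,
    ← Complex.ofReal_mul, ← mul_inv, Real.mul_self_sqrt hba.le]
  congr 2
  push_cast
  ring

/-- "`(ξ_α)_k = L⁻¹ ∫_{−L/2}^{L/2} exp(2πi(α−k)x/L) dx`" (proof of Lemma 6.6, p. 25), for a general interval:
`⟨ξ_α|ξ_β⟩ = ∫_I κ_{β−α} = L⁻¹∫_a^b e^{2πi(β−α)x/L} dx`. [cite: ConnesConsani2021, Lemma 6.6 §6.6 p. 25 (proof)] -/
theorem inner_expVector_expVector (hab : a < b) (α β : ℝ) :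
    ⟪expVector a b α, expVector a b β⟫_ℂ = ∫ x in Icc a b, expKernel a b (β - α) x := by
  rw [inner_expVector_left]
  refine integral_congr_ae ?_
  filter_upwards [coeFn_expVector a b β] with x hx
  rw [hx, conj_expFun_mul_expFun hab]

/-- **The Gram matrix `J_{i,j} = ⟨ξ̃_i|ξ̃_j⟩` of the vectors `ξ_α` on CC's interval `[−L/2, L/2]`**
(`L = log 2`): "`(ξ_α)_k = L⁻¹∫_{−L/2}^{L/2} exp(2πi(α−k)x/L) dx = sin(π(α−k))/(π(α−k))`" (proof of
Lemma 6.6 = arXiv Lemma 39, p. 25; the matrix `J` of §6.6 p. 26): `⟨ξ_α|ξ_β⟩ = sinc(π(β − α))`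
(`Real.sinc x = sin x / x`, `sinc 0 = 1`). [cite: ConnesConsani2021, Lemma 6.6 §6.6 pp. 25–26 (proof)] -/
theorem inner_expVector_expVector_symm {L : ℝ} (hL : 0 < L) (α β : ℝ) :
    ⟪expVector (-(L / 2)) (L / 2) α, expVector (-(L / 2)) (L / 2) β⟫_ℂ
      = ((Real.sinc (π * (β - α)) : ℝ) : ℂ) := by
  have hab : -(L / 2) < L / 2 := by linarith
  have hLba : L / 2 - -(L / 2) = L := by ring
  rw [inner_expVector_expVector hab, integral_Icc_eq_integral_Ioc,
    ← intervalIntegral.integral_of_le hab.le]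
  rcases eq_or_ne β α with h | h
  · subst h
    simp only [sub_self, expKernel_freq_zero, hLba, intervalIntegral.integral_const, mul_zero,
      Real.sinc_zero, Complex.ofReal_one]
    rw [Complex.real_smul, ← Complex.ofReal_mul, mul_inv_cancel₀ hL.ne', Complex.ofReal_one]
  · set γ : ℝ := 2 * π * (β - α) / L with hγ
    have hγ0 : γ ≠ 0 := by
      rw [hγ]
      exact div_ne_zero (mul_ne_zero (mul_ne_zero two_ne_zero Real.pi_ne_zero) (sub_ne_zero.2 h))
        hL.ne'
    have hr : γ * (L / 2) = π * (β - α) := by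
      rw [hγ]
      field_simp
    have hint : ∫ x in -(L / 2)..L / 2, expKernel (-(L / 2)) (L / 2) (β - α) x
        = (((L⁻¹ : ℝ)) : ℂ) * ∫ x in -(L / 2)..L / 2, Complex.exp (((γ * x : ℝ) : ℂ) * I) := by
      rw [← intervalIntegral.integral_const_mul]
      refine intervalIntegral.integral_congr fun x _ ↦ ?_
      simp only [expKernel, hLba]
      congr 2
      rw [hγ]
      push_cast
      ring
    rw [hint, intervalIntegral.integral_comp_mul_left (fun u : ℝ ↦ Complex.exp ((u : ℂ) * I)) hγ0,
      mul_neg, integral_exp_mul_I_eq_sinc, ← hr, Complex.real_smul]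
    have hL0 : (L : ℂ) ≠ 0 := Complex.ofReal_ne_zero.2 hL.ne'
    have hγ0' : (γ : ℂ) ≠ 0 := Complex.ofReal_ne_zero.2 hγ0
    push_cast
    field_simp

/-- **"the vectors `ξ_n` form an orthonormal basis of `𝓗`"** (proof of Lemma 6.4, p. 25) — the
orthonormality of `(ξ_n)_{n∈ℤ}` on `[−L/2, L/2]` (`sinc(π(k − n)) = δ_{nk}`); completeness is not typed
here. [cite: ConnesConsani2021, Lemma 6.4 §6.5 p. 25 (proof)] -/
theorem orthonormal_expVector_int {L : ℝ} (hL : 0 < L) :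
    Orthonormal ℂ (fun n : ℤ ↦ expVector (-(L / 2)) (L / 2) n) := by
  rw [orthonormal_iff_ite]
  intro n k
  rw [inner_expVector_expVector_symm hL]
  split_ifs with h
  · subst h
    simp [Real.sinc_zero]
  · have hk : (k : ℝ) - n ≠ 0 := sub_ne_zero.2 (by exact_mod_cast (Ne.symm h))
    rw [Real.sinc_of_ne_zero (mul_ne_zero Real.pi_ne_zero hk),
      show π * ((k : ℝ) - n) = ((k - n : ℤ) : ℝ) * π by push_cast; ring, Real.sin_int_mul_pi]
    simp

end Literature.NumberTheory.ConnesConsani2021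

end
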